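import Summits.CriticalPhenomena.PercolationContinuityZ3.Statement
import Summits.CriticalPhenomena.PercolationContinuityZ3.Theses.PercBurnResprinkle
import Literature.Probability.Percolation.PercolationProofs
import Literature.Probability.Percolation.StaticRenormalizationBlocks
import Literature.Probability.Percolation.BondPercolationSymmetry
import Literature.Probability.Percolation.UniformPercolation
import Literature.Probability.Percolation.CriticalContinuity
import Literature.Probability.LatticeModels.StarBoundary
import Summits.CriticalPhenomena.PercolationContinuityZ3.Theorems.PercBurnResprinkleVacantReignitionDuality
import Summits.CriticalPhenomena.PercolationContinuityZ3.Theorems.PercBurnResprinkleVacantReignitionCoarsePercolationAux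
import Summits.CriticalPhenomena.PercolationContinuityZ3.Theorems.VacantReignition.Negative.HarmlessShadowForcesContinuity
import Summits.CriticalPhenomena.PercolationContinuityZ3.Theorems.PercBurnResprinkleVacantReignitionCurtain
import Summits.CriticalPhenomena.PercolationContinuityZ3.Theorems.VacantReignition.Negative.VacantReignitionNeedsVacantSet
import HarnessLib

/-!
# Tightness of the engine of line `slab-slice-avoidability` (crux stmt-CriticalPhenomena-7203):
# `CurtainDust` FORCES `θ(p_c) = 0` on `ℤ³`, and needs `VacantSetPercolates`

Continuation lead prover-line-stmt-CriticalPhenomena-7203-c2-0, 2026-08-17 (negative-lane accounting, cf.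
`Negative/HarmlessShadowForcesContinuity.lean` for line holes-are-fresh and `Negative/NoCagesFatJumpVacancyDecay.lean`
for line strip-fresh-field-lss).

The ENGINE `CurtainDust` (registered open stub `stub_curtainDust`; `Theorems.vacantReignition_of_curtainDust` proves
`CurtainDust → VacantReignition`) is a HIGH-PROBABILITY first-passage statement about the critical arm shadow at block
resolution: for every aspect `k ≥ 1` and `η > 0` there is `κ > 0` such that for arbitrarily large block scales `L`
and arbitrarily large coarse ratios `S`, with probability `≥ 1 - η`, every self-avoiding `★`-chain of blocks of the
square `{|zᵢ| ≤ 3S}` of extent `≥ S` carries at least `κ·(length)` UNTOUCHED blocks.  The order of quantifiers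
(`κ` BEFORE `L`) is what makes it continuity-strength by a first-moment argument, although in its regime (`L` fixed,
`S → ∞`) the union bound of `harmlessShadow_forces_continuity` is not available: in a JUMP world (`θ(p_c) > 0`) a
block is untouched with probability `< κ/2` once `L` is large (`harmlessShadow_untouched_lt`), so on the straight
chain `γ₀ = [(0,0), (1,0), …, (S,0)]` (self-avoiding, `★`-chain, extent `S`, inside the square) the EXPECTED number
of untouched blocks is `< (S+1) κ/2`, and by Markov's inequality (`curtainDust_mul_measureReal_le_sum`) the event
"`γ₀` carries `≥ κ (S+1)` untouched blocks" — implied by `CurtainOK` — has probability `< 1/2`, uniformly in `S`;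
so `¬CurtainOK` has probability `> 1/2 > 1/4 = η`, contradicting the engine at `k = 1`.  Hence

* `curtainDust_forces_continuity : CurtainDust → PercolationContinuityZ3` (`θ(p_c(ℤ³)) = 0`), and
* `curtainDust_imp_vacantSetPercolates : CurtainDust → VacantSetPercolates` (the kill chain through the landed line
  theorem and `vacantSetPercolates_of_vacantReignition`: the engine is at least as strong as the sibling crux
  stmt-CriticalPhenomena-7205, i.e. Grimmett–Holroyd–Kozma's `p_c < p_fin` for `d = 3`).

So the engine is CONTINUITY-STRENGTH — as every S1-engine at `p_c` must be (refuter anatomy C4: S1 ⟹ ¬FireBreak);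
recorded as theorems so that the planners read the exact status: closing `stub_curtainDust` closes the sub-problem
`PercolationContinuityZ3` DIRECTLY (this file) and the crux `VacantReignition` (`PercBurnResprinkleVacantReignitionCurtain.lean`),
without `JumpFireBreak`.  No new definitions.
-/

noncomputable section

namespace Summit.CriticalPhenomena.PercolationContinuityZ3.Theorems

open MeasureTheory Set
open scoped ENNReal
open Literature.Probability.Percolation Literature.Probability.LatticeModels

/-- **Markov's inequality for counts of events.**  In a finite measure space, if every point of `A` lies in at
least `r` (a real threshold) of the measurable sets `B z`, `z ∈ R` (witnessed by a sub-finset `F ⊆ R` with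
`r ≤ #F`), then `r · μ(A) ≤ Σ_{z ∈ R} μ(B z)` (`mul_meas_ge_le_lintegral` for the sum of the indicators).
[folklore] -/
theorem curtainDust_mul_measureReal_le_sum {Ω ι : Type*} [MeasurableSpace Ω] (μ : Measure Ω) [IsFiniteMeasure μ]
    (R : Finset ι) (B : ι → Set Ω) (hB : ∀ z ∈ R, MeasurableSet (B z)) (r : ℝ) {A : Set Ω}
    (hA : ∀ ω ∈ A, ∃ F : Finset ι, F ⊆ R ∧ r ≤ (F.card : ℝ) ∧ ∀ z ∈ F, ω ∈ B z) :
    r * μ.real A ≤ ∑ z ∈ R, μ.real (B z) := by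
  classical
  set m : ℕ := ⌈r⌉₊ with hm
  set f : Ω → ℝ≥0∞ := fun ω => ∑ z ∈ R, (B z).indicator 1 ω with hf
  have hfm : Measurable f := by
    rw [hf]
    exact Finset.measurable_sum _ fun z hz => measurable_one.indicator (hB z hz)
  have hAC : A ⊆ {ω | (m : ℝ≥0∞) ≤ f ω} := by
    intro ω hω
    obtain ⟨F, hFR, hrF, hF⟩ := hA ω hω
    have hmF : m ≤ F.card := Nat.ceil_le.2 hrF
    show (m : ℝ≥0∞) ≤ ∑ z ∈ R, (B z).indicator 1 ω
    calc (m : ℝ≥0∞) ≤ (F.card : ℝ≥0∞) := by exact_mod_cast hmF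
      _ = ∑ z ∈ F, (B z).indicator (1 : Ω → ℝ≥0∞) ω := by
          rw [Finset.card_eq_sum_ones, Nat.cast_sum]
          refine Finset.sum_congr rfl fun z hz => ?_
          rw [Set.indicator_of_mem (hF z hz)]
          simp
      _ ≤ ∑ z ∈ R, (B z).indicator (1 : Ω → ℝ≥0∞) ω := Finset.sum_le_sum_of_subset hFR
  have hint : ∫⁻ ω, f ω ∂μ = ∑ z ∈ R, μ (B z) := by
    rw [hf, lintegral_finsetSum _ (fun z hz => measurable_one.indicator (hB z hz))]
    exact Finset.sum_congr rfl fun z hz => lintegral_indicator_one (hB z hz)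
  have h1 : (m : ℝ≥0∞) * μ A ≤ ∑ z ∈ R, μ (B z) :=
    calc (m : ℝ≥0∞) * μ A ≤ (m : ℝ≥0∞) * μ {ω | (m : ℝ≥0∞) ≤ f ω} :=
          mul_le_mul_of_nonneg_left (measure_mono hAC) bot_le
      _ ≤ ∫⁻ ω, f ω ∂μ := mul_meas_ge_le_lintegral hfm _
      _ = _ := hint
  have hne : ∑ z ∈ R, μ (B z) ≠ ∞ := ENNReal.sum_ne_top.2 fun z _ => measure_ne_top _ _
  have h2 : (m : ℝ) * μ.real A ≤ ∑ z ∈ R, μ.real (B z) := by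
    have h3 := ENNReal.toReal_mono hne h1
    rw [ENNReal.toReal_mul, ENNReal.toReal_natCast, ENNReal.toReal_sum (fun z _ => measure_ne_top _ _)] at h3
    simpa only [measureReal_def] using h3
  calc r * μ.real A ≤ (m : ℝ) * μ.real A := mul_le_mul_of_nonneg_right (Nat.le_ceil r) measureReal_nonneg
    _ ≤ _ := h2

/-- The straight chain of block indices `γ₀ = [(0,0), (1,0), …, (S,0)]` is self-avoiding. [folklore] -/
theorem curtainDust_straightChain_nodup (S : ℕ) :
    ((List.range (S + 1)).map (fun j : ℕ => (![(j : ℤ), 0] : Fin 2 → ℤ))).Nodup := by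
  refine (List.nodup_range).map fun a b hab => ?_
  have h := congrFun hab 0
  simp only [Matrix.cons_val_zero, Nat.cast_inj] at h
  exact h

/-- The straight chain `γ₀` is a `★`-chain (consecutive blocks differ by `1` in the first coordinate). [folklore] -/
theorem curtainDust_straightChain_isChain (S : ℕ) :
    List.IsChain (fun a b => (zdStar 2).Adj a b)
      ((List.range (S + 1)).map (fun j : ℕ => (![(j : ℤ), 0] : Fin 2 → ℤ))) := by
  rw [List.isChain_map, List.isChain_range_succ]
  intro m _
  refine vacantReignition_du_zdStar_adj_of_coord (Or.inl ?_) ?_ ?_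
  · simp
  · simp
  · simp

/-- Membership in the straight chain `γ₀`: exactly the blocks `(j, 0)`, `j ≤ S`. [folklore] -/
theorem curtainDust_mem_straightChain {S : ℕ} {z : Fin 2 → ℤ} :
    z ∈ (List.range (S + 1)).map (fun j : ℕ => (![(j : ℤ), 0] : Fin 2 → ℤ)) ↔ ∃ j : ℕ, j ≤ S ∧ z = ![(j : ℤ), 0] := by
  rw [List.mem_map]
  constructor
  · rintro ⟨j, hj, rfl⟩
    exact ⟨j, Nat.lt_succ_iff.1 (List.mem_range.1 hj), rfl⟩
  · rintro ⟨j, hj, rfl⟩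
    exact ⟨j, List.mem_range.2 (Nat.lt_succ_iff.2 hj), rfl⟩

/-- **The engine of line slab-slice-avoidability forces continuity**: `CurtainDust → θ(p_c(ℤ³)) = 0`.
The hypothesis is the registered open stub `stub_curtainDust` verbatim (def-free).  Proof: if `θ(p_c) > 0`,
take `k = 1`, `η = 1/4`, the engine's `κ`; for `L` beyond the `L₀` of `harmlessShadow_untouched_lt` (with
`η' = κ/2`) the engine supplies a scale `L` and then a ratio `S ≥ 4` at which `¬CurtainOK` has probability `≤ 1/4`;
but on the straight chain `γ₀` (self-avoiding, `★`-chain, extent `S`, inside the square) Markov's inequality gives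
`κ (S+1) · P(CurtainOK) ≤ Σ_{z ∈ γ₀} P(z untouched) < (S+1) κ/2`, so `P(CurtainOK) < 1/2` and `P(¬CurtainOK) > 1/2`.
[cite: AhlbergEtAl2015, §2 (the role of θ(p_c) = 0 in Lemma 3)] -/
theorem curtainDust_forces_continuity :
    (∀ k : ℕ, 1 ≤ k → ∀ η : ℝ, 0 < η → ∃ κ : ℝ, 0 < κ ∧ ∀ L₁ : ℕ, ∃ L : ℕ, L₁ ≤ L ∧ ∀ S₁ : ℕ, ∃ S : ℕ, S₁ ≤ S ∧
      (labelMeasure (Fin 3 → ℤ)).real {U : (Sym2 (Fin 3 → ℤ) → ℝ) |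
        ¬ (∀ γ : List (Fin 2 → ℤ), γ.Nodup → List.IsChain (fun a b => (zdStar 2).Adj a b) γ → (∀ z ∈ γ, (∀ i, |z i - (S : ℤ) * (0 : Fin 2 → ℤ) i| ≤ 3 * (S : ℤ))) → (∃ z ∈ γ, ∃ z' ∈ γ, ∃ i, (S : ℤ) ≤ |z i - z' i|) → ∃ F : Finset (Fin 2 → ℤ), (∀ z ∈ F, z ∈ γ ∧ ¬ (∃ y ∈ (↑(box 3 (blockR L k)) : Set (Fin 3 → ℤ)), BondConfig.relabel (sym2Equiv (Site.shift (-(((2 * L + 1 : ℕ) : ℤ) • (![0, z 0, z 1] : Fin 3 → ℤ))))) (configOfLabels (criticalProb (zdGraph 3) (0 : Fin 3 → ℤ)) U (zdGraph 3)) ∈ boxArm (S * (2 * L + 1)) y)) ∧ κ * (γ.length : ℝ) ≤ (F.card : ℝ))} ≤ η) →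
    _root_.PercolationContinuityZ3 := by
  intro hE
  show theta (zdGraph 3) (0 : Fin 3 → ℤ) (criticalProbI 3) = 0
  have hprob : IsProbabilityMeasure (labelMeasure (Fin 3 → ℤ)) := isProbabilityMeasure_labelMeasure _
  by_contra hne
  have hθ : 0 < theta (zdGraph 3) (0 : Fin 3 → ℤ) (criticalProbI 3) :=
    lt_of_le_of_ne measureReal_nonneg (Ne.symm hne)
  obtain ⟨κ, hκ, hEng⟩ := hE 1 le_rfl (1 / 4) (by norm_num)
  obtain ⟨L₀, hL₀⟩ := harmlessShadow_untouched_lt hθ (η' := κ / 2) (by positivity)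
  obtain ⟨L, hLL, hEngL⟩ := hEng L₀
  obtain ⟨S, hS4, hCurt⟩ := hEngL 4
  have hkS : 1 + 3 ≤ S := by omega
  -- the straight chain and the touched events of its blocks
  set γ₀ : List (Fin 2 → ℤ) := (List.range (S + 1)).map (fun j : ℕ => (![(j : ℤ), 0] : Fin 2 → ℤ)) with hγ₀
  set T : (Fin 2 → ℤ) → Set (Sym2 (Fin 3 → ℤ) → ℝ) := fun z => {U |
    ∃ y ∈ (↑(box 3 (blockR L 1)) : Set (Fin 3 → ℤ)),
      BondConfig.relabel (sym2Equiv (Site.shift (-(((2 * L + 1 : ℕ) : ℤ) • (![0, z 0, z 1] : Fin 3 → ℤ)))))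
        (configOfLabels (criticalProb (zdGraph 3) (0 : Fin 3 → ℤ)) U (zdGraph 3)) ∈ boxArm (S * (2 * L + 1)) y} with hT
  have hTc : ∀ z : Fin 2 → ℤ, (labelMeasure (Fin 3 → ℤ)).real (T z)ᶜ < κ / 2 :=
    fun z => hL₀ L hLL 1 S hkS _
  have hTm : ∀ z : Fin 2 → ℤ, MeasurableSet (T z)ᶜ := fun z =>
    (measurableSet_setOf.2 (vacantReignition_cp_measurable_touched _ _ _ _)).compl
  set R : Finset (Fin 2 → ℤ) := γ₀.toFinset with hR
  have hγ₀len : γ₀.length = S + 1 := by rw [hγ₀, List.length_map, List.length_range]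
  have hRcard : R.card = S + 1 := by
    rw [hR, List.toFinset_card_of_nodup (curtainDust_straightChain_nodup S), hγ₀len]
  -- the CurtainOK event and its first-moment bound
  set A : Set (Sym2 (Fin 3 → ℤ) → ℝ) := {U |
    ∀ γ : List (Fin 2 → ℤ), γ.Nodup → List.IsChain (fun a b => (zdStar 2).Adj a b) γ →
      (∀ z ∈ γ, (∀ i, |z i - (S : ℤ) * (0 : Fin 2 → ℤ) i| ≤ 3 * (S : ℤ))) →
      (∃ z ∈ γ, ∃ z' ∈ γ, ∃ i, (S : ℤ) ≤ |z i - z' i|) →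
      ∃ F : Finset (Fin 2 → ℤ), (∀ z ∈ F, z ∈ γ ∧ ¬ (∃ y ∈ (↑(box 3 (blockR L 1)) : Set (Fin 3 → ℤ)),
        BondConfig.relabel (sym2Equiv (Site.shift (-(((2 * L + 1 : ℕ) : ℤ) • (![0, z 0, z 1] : Fin 3 → ℤ)))))
          (configOfLabels (criticalProb (zdGraph 3) (0 : Fin 3 → ℤ)) U (zdGraph 3)) ∈ boxArm (S * (2 * L + 1)) y)) ∧
        κ * (γ.length : ℝ) ≤ (F.card : ℝ)} with hA
  have hAF : ∀ U ∈ A, ∃ F : Finset (Fin 2 → ℤ), F ⊆ R ∧ κ * ((S : ℝ) + 1) ≤ (F.card : ℝ) ∧ ∀ z ∈ F, U ∈ (T z)ᶜ := by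
    intro U hU
    have hreg : ∀ z ∈ γ₀, ∀ i, |z i - (S : ℤ) * (0 : Fin 2 → ℤ) i| ≤ 3 * (S : ℤ) := by
      intro z hz i
      obtain ⟨j, hj, rfl⟩ := curtainDust_mem_straightChain.1 hz
      fin_cases i
      · simp
        omega
      · simp
    have hext : ∃ z ∈ γ₀, ∃ z' ∈ γ₀, ∃ i, (S : ℤ) ≤ |z i - z' i| := by
      refine ⟨![((S : ℕ) : ℤ), 0], curtainDust_mem_straightChain.2 ⟨S, le_rfl, rfl⟩,
        ![((0 : ℕ) : ℤ), 0], curtainDust_mem_straightChain.2 ⟨0, Nat.zero_le _, rfl⟩, 0, ?_⟩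
      simp
    obtain ⟨F, hF, hκF⟩ := hU γ₀ (curtainDust_straightChain_nodup S) (curtainDust_straightChain_isChain S) hreg hext
    refine ⟨F, fun z hz => ?_, ?_, fun z hz => (hF z hz).2⟩
    · rw [hR, List.mem_toFinset]; exact (hF z hz).1
    · rw [hγ₀len] at hκF; push_cast at hκF; exact hκF
  have hmarkov := curtainDust_mul_measureReal_le_sum (labelMeasure (Fin 3 → ℤ)) R (fun z => (T z)ᶜ)
    (fun z _ => hTm z) (κ * ((S : ℝ) + 1)) hAF
  have hsum : ∑ z ∈ R, (labelMeasure (Fin 3 → ℤ)).real (T z)ᶜ < ((S : ℝ) + 1) * (κ / 2) := by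
    have hRne : R.Nonempty := by
      rw [← Finset.card_pos, hRcard]; omega
    calc ∑ z ∈ R, (labelMeasure (Fin 3 → ℤ)).real (T z)ᶜ
        < ∑ _z ∈ R, κ / 2 := Finset.sum_lt_sum_of_nonempty hRne fun z _ => hTc z
      _ = ((S : ℝ) + 1) * (κ / 2) := by rw [Finset.sum_const, nsmul_eq_mul, hRcard]; push_cast; ring
  have hAlt : (labelMeasure (Fin 3 → ℤ)).real A < 1 / 2 := by
    have hS1 : (0 : ℝ) < κ * ((S : ℝ) + 1) := by positivity
    by_contra hge
    push Not at hge
    have : κ * ((S : ℝ) + 1) * (1 / 2) ≤ κ * ((S : ℝ) + 1) * (labelMeasure (Fin 3 → ℤ)).real A :=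
      mul_le_mul_of_nonneg_left hge hS1.le
    linarith
  -- complement: `¬CurtainOK` has probability > 1/2 > 1/4
  have hcompl : (1 : ℝ) ≤ (labelMeasure (Fin 3 → ℤ)).real A + (labelMeasure (Fin 3 → ℤ)).real Aᶜ := by
    have h1 := measure_univ_le_add_compl (μ := labelMeasure (Fin 3 → ℤ)) A
    rw [measure_univ] at h1
    have h2 : ((labelMeasure (Fin 3 → ℤ)) A + (labelMeasure (Fin 3 → ℤ)) Aᶜ).toReal =
        (labelMeasure (Fin 3 → ℤ)).real A + (labelMeasure (Fin 3 → ℤ)).real Aᶜ := by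
      rw [ENNReal.toReal_add (measure_ne_top _ _) (measure_ne_top _ _), measureReal_def, measureReal_def]
    rw [← h2]
    have h3 : (1 : ℝ) = (1 : ℝ≥0∞).toReal := by simp
    rw [h3]
    exact ENNReal.toReal_mono (ENNReal.add_ne_top.2 ⟨measure_ne_top _ _, measure_ne_top _ _⟩) h1
  have hbig : 1 / 2 < (labelMeasure (Fin 3 → ℤ)).real Aᶜ := by linarith
  have hle : (labelMeasure (Fin 3 → ℤ)).real Aᶜ ≤ 1 / 4 := by
    refine le_trans (le_of_eq ?_) hCurt
    rw [hA, Set.compl_setOf]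
  linarith

/-- **The engine needs the vacant set to percolate**: `CurtainDust → VacantSetPercolates` — the kill chain of the
line through the landed line theorem `vacantReignition_of_curtainDust` and the landed implication
`vacantSetPercolates_of_vacantReignition` (crux 7203 ⇒ crux 7205).  So `stub_curtainDust` contains the sibling crux
stmt-CriticalPhenomena-7205 (Grimmett–Holroyd–Kozma's `p_c < p_fin` for `d = 3`). [cite: AhlbergEtAl2015, §2 (Thm 2 ⇒ vacant-set percolation)] -/
theorem curtainDust_imp_vacantSetPercolates
    (h : ∀ k : ℕ, 1 ≤ k → ∀ η : ℝ, 0 < η → ∃ κ : ℝ, 0 < κ ∧ ∀ L₁ : ℕ, ∃ L : ℕ, L₁ ≤ L ∧ ∀ S₁ : ℕ, ∃ S : ℕ, S₁ ≤ S ∧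
      (labelMeasure (Fin 3 → ℤ)).real {U : (Sym2 (Fin 3 → ℤ) → ℝ) |
        ¬ (∀ γ : List (Fin 2 → ℤ), γ.Nodup → List.IsChain (fun a b => (zdStar 2).Adj a b) γ → (∀ z ∈ γ, (∀ i, |z i - (S : ℤ) * (0 : Fin 2 → ℤ) i| ≤ 3 * (S : ℤ))) → (∃ z ∈ γ, ∃ z' ∈ γ, ∃ i, (S : ℤ) ≤ |z i - z' i|) → ∃ F : Finset (Fin 2 → ℤ), (∀ z ∈ F, z ∈ γ ∧ ¬ (∃ y ∈ (↑(box 3 (blockR L k)) : Set (Fin 3 → ℤ)), BondConfig.relabel (sym2Equiv (Site.shift (-(((2 * L + 1 : ℕ) : ℤ) • (![0, z 0, z 1] : Fin 3 → ℤ))))) (configOfLabels (criticalProb (zdGraph 3) (0 : Fin 3 → ℤ)) U (zdGraph 3)) ∈ boxArm (S * (2 * L + 1)) y)) ∧ κ * (γ.length : ℝ) ≤ (F.card : ℝ))} ≤ η) :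
    Summit.CriticalPhenomena.PercolationContinuityZ3.Theses.PercBurnResprinkle.VacantSetPercolates :=
  vacantSetPercolates_of_vacantReignition (vacantReignition_of_curtainDust h)

end Summit.CriticalPhenomena.PercolationContinuityZ3.Theorems

end
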